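import Summits.CriticalPhenomena.Ising3D.TaylorLegendreMoments
import Summits.CriticalPhenomena.Ising3D.TaylorOddConeRegionCheck
import Summits.CriticalPhenomena.Ising3D.TaylorHalfStripPos2
import Summits.CriticalPhenomena.Ising3D.TaylorOddConeQPoly
import Mathlib.Tactic.Linarith
import Mathlib.Tactic.Positivity
import Mathlib.Tactic.Ring
import Mathlib.Tactic.FieldSimp
import HarnessLib

/-!
# The EXACT `(E, j)`-polynomial region checks (both sectors): no kernel-route loss
(cell `pub-ising3x`, seat recog-1 gen 11; gate (g2) — the region layer of the TABLE theorem at the strength of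
the float probe's `(E, J)` tables, kernel-checkable)

HONEST FRAMING: lottery ticket; floor = tightest certified 3D Ising CFT bounds; no exact-solution
claim without a proof.

By `qSum_eq_sum_hMoment_PDL` every weighted q-sum is `q̂(E, j) = Σ_k row_{2k}(E - cc) · hMoment k j` with the
rows of the `(P, D)` table, and by `TaylorLegendreMoments` each `hMoment k` is a polynomial `H_k(j)` with a
computable coefficient list. Substituting `j = θ·E` (`θ ∈ [0,1]` ⊇ all integers `0 ≤ j ≤ E`, `E = P + cc`) gives a
bivariate table `G(P, θ) = Σ_r [Σ_k h_{k,r} row_{2k}(P) (P+cc)^r] θ^r` (`momTable`, `momTableI`,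
`qSum_eq_eval2_momTable`) — and the half-strip checker v2 (`TaylorHalfStripPos2`: θ-cells × shifted-sign tail test + `posOn`) decides its positivity.
Results: `EvenRegionDataEJ.check = true → TaylorEvenRegion …` (through boot-1's `taylorEvenRegion_half_of_qRegion`,
i.e. the λ-AVERAGED termwise condition, not the pointwise kernel one) and `OddConeRegionDataEJ.check = true →`
the `odd_cone` field (through `oddConeAt_half_of_qCone`). Compared with `TaylorKernelRegionCheck` the only
relaxation left is `j` real in `[0, E]` instead of integer. SUFFICIENT (interval slack). Elementary. [folklore]
-/

namespace Summit.CriticalPhenomena.Ising3D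

open Finset Set
open Literature.Analysis.ValidatedNumerics Literature.Analysis.ValidatedNumerics.PolyMP
open Literature.Analysis.ValidatedNumerics.NumericsMP (MI)
open Literature.MathematicalPhysics.QuantumFieldTheory.ConformalBootstrap3D

/-! ### q-sums in row form -/

/-- **Row form of a q-sum**: `q̂(E, j) = Σ_{k<N} row_{2k}(E - cc) · hMoment k j`, `N ≥ size2` of the table. [folklore] -/
theorem qSum_eq_sum_rows (c : ℕ × ℕ → ℝ) {l : List (ℕ × ℕ)} (hl : l.Nodup) (s σ cc : ℝ) {N : ℕ}
    (hN : size2 (kernelPDL c l s σ cc) ≤ N) (E : ℝ) (j : ℕ) :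
    qSum c l.toFinset s σ E j =
      ∑ k ∈ range N, evalR ((kernelPDL c l s σ cc).getD (2 * k) []) (E - cc) * hMoment k j := by
  rw [qSum_eq_sum_hMoment_PDL c hl s σ cc E j, Finset.sum_product_right]
  set Q := kernelPDL c l s σ cc with hQ
  have hrow : ∀ k : ℕ, ∑ m ∈ range (size2 Q), coeff2 Q m (2 * k) * ((E - cc) ^ m * hMoment k j) =
      evalR (Q.getD (2 * k) []) (E - cc) * hMoment k j := by
    intro k
    rw [evalR_eq_sum_pad (Q.getD (2 * k) []) (length_getD_le_size2 Q (2 * k)), Finset.sum_mul]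
    exact Finset.sum_congr rfl fun m _ => by rw [coeff2]; ring
  simp_rw [hrow]
  refine Finset.sum_subset (range_subset_range.2 hN) fun k hk hk' => ?_
  have hk2 : size2 Q ≤ 2 * k := by simp only [Finset.mem_range, not_lt] at hk hk'; omega
  rw [List.getD_eq_default _ _ ((length_le_size2 Q).trans hk2), evalR_nil, zero_mul]

/-! ### The substitution `j = θ (P + cc)` -/

/-- Coefficient `r` of the moment polynomial `H_k`. [folklore] -/
def momCoeff (k r : ℕ) : ℚ := (hMomentListQ k).getD r 0

/-- The substituted shadow table: row `r` (power of `θ`) is `Σ_{k<N} h_{k,r} · row_{2k}(P) · (P+cc)^r`. [folklore] -/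
noncomputable def substMom (Q : List (List ℝ)) (cc : ℝ) (N R : ℕ) : List (List ℝ) :=
  (List.range R).map fun r => sumR (fun k => smulR (momCoeff k r : ℝ) (mulR (Q.getD (2 * k) []) (powShiftR cc r))) N

/-- Interval twin. [folklore] -/
def substMomI (S : ℕ) (QI : IPoly2) (cc : ℚ) (N R : ℕ) : IPoly2 :=
  (List.range R).map fun r => sumI (fun k => smulQI (momCoeff k r) (mulI S (QI.getD (2 * k) []) (powShiftI S cc r))) N

/-- [folklore] -/
theorem pmem2_substMomI {S : ℕ} (hS : 0 < S) {Q : List (List ℝ)} {QI : IPoly2} (h : PMem2 S Q QI) (cc : ℚ)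
    (N R : ℕ) : PMem2 S (substMom Q (cc : ℝ) N R) (substMomI S QI cc N R) :=
  pmem2_map_of_mem (fun r => pmem_sumI N fun k _ =>
    pmem_smulQI _ rfl (pmem_mulI hS (pmem_getD_of_pmem2 h (2 * k)) (pmem_powShiftI S cc r))) _

/-- [folklore] -/
theorem eval2_substMom (Q : List (List ℝ)) (cc : ℝ) (N R : ℕ) (P θ : ℝ) :
    eval2 (substMom Q cc N R) P θ =
      ∑ k ∈ range N, evalR (Q.getD (2 * k) []) P * ∑ r ∈ range R, (momCoeff k r : ℝ) * (θ * (P + cc)) ^ r := by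
  rw [eval2, substMom, List.map_map]
  have : ((fun l => evalR l P) ∘ fun r => sumR (fun k => smulR (momCoeff k r : ℝ)
      (mulR (Q.getD (2 * k) []) (powShiftR cc r))) N) =
      fun r => ∑ k ∈ range N, (momCoeff k r : ℝ) * (evalR (Q.getD (2 * k) []) P * (P + cc) ^ r) := by
    funext r
    simp only [Function.comp_apply, evalR_sumR, evalR_smulR, evalR_mulR, evalR_powShiftR]
  rw [this, evalR_map_range]
  simp_rw [Finset.sum_mul, Finset.mul_sum]
  rw [Finset.sum_comm]
  exact Finset.sum_congr rfl fun k _ => Finset.sum_congr rfl fun r _ => by rw [mul_pow]; ring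

/-- [folklore] -/
theorem getD_map_ratCast (l : List ℚ) : ∀ r : ℕ, (l.map ((↑) : ℚ → ℝ)).getD r 0 = ((l.getD r 0 : ℚ) : ℝ) := by
  induction l with
  | nil => intro r; simp
  | cons a l ih =>
      intro r
      cases r with
      | zero => simp
      | succ n => simp only [List.map_cons, List.getD_cons_succ]; exact ih n

/-- `H_k(t)` through its padded coefficient sum, `R ≥ |hMomentListQ k|`. [folklore] -/
theorem hMoment_eq_sum_momCoeff {k R : ℕ} (hR : (hMomentListQ k).length ≤ R) (j : ℕ) :
    hMoment k j = ∑ r ∈ range R, (momCoeff k r : ℝ) * (j : ℝ) ^ r := by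
  have hlen : ((hMomentListQ k).map ((↑) : ℚ → ℝ)).length ≤ R := by rw [List.length_map]; exact hR
  rw [← evalR_hMomentListQ, evalR_eq_sum_pad _ hlen]
  refine Finset.sum_congr rfl fun r _ => ?_
  rw [getD_map_ratCast, momCoeff]

/-- The moment-length condition `∀ k < N, |hMomentListQ k| ≤ R` (decidable). [folklore] -/
def momLenOK (N R : ℕ) : Bool := (List.range N).all fun k => decide ((hMomentListQ k).length ≤ R)

/-- [folklore] -/
theorem momLen_of_ok {N R : ℕ} (h : momLenOK N R = true) {k : ℕ} (hk : k < N) : (hMomentListQ k).length ≤ R := by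
  have := List.all_eq_true.mp h k (List.mem_range.mpr hk)
  exact of_decide_eq_true this

/-- **The q-sum through the substituted table**: for `0 < E`, integer `j ≤ E`,
`q̂(E, j) = eval2 (substMom table cc N R) (E - cc) (j/E)`. [folklore] -/
theorem qSum_eq_eval2_substMom (c : ℕ × ℕ → ℝ) {l : List (ℕ × ℕ)} (hl : l.Nodup) (s σ cc : ℝ) {N R : ℕ}
    (hN : size2 (kernelPDL c l s σ cc) ≤ N) (hR : momLenOK N R = true) {E : ℝ} (hE : 0 < E) (j : ℕ) :
    qSum c l.toFinset s σ E j = eval2 (substMom (kernelPDL c l s σ cc) cc N R) (E - cc) ((j : ℝ) / E) := by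
  rw [qSum_eq_sum_rows c hl s σ cc hN E j, eval2_substMom]
  refine Finset.sum_congr rfl fun k hk => ?_
  rw [show E - cc + cc = E by ring, div_mul_cancel₀ _ hE.ne',
    hMoment_eq_sum_momCoeff (momLen_of_ok hR (Finset.mem_range.mp hk)) j]

/-! ### One substituted table per component -/

/-- The substituted interval table of the component `(cQ, s ∈ sI, σQ)`. [folklore] -/
def momTableI (S : ℕ) (cQ : ℕ × ℕ → ℚ) (σQ : ℚ) (sI : MI) (ccQ : ℚ) (l : List (ℕ × ℕ)) (N R : ℕ) : IPoly2 :=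
  substMomI S (kernelPDLI S cQ σQ (signedChooseI S sI) ccQ l) ccQ N R

/-- Its real shadow. [folklore] -/
noncomputable def momTable (cQ : ℕ × ℕ → ℚ) (σQ : ℚ) (s : ℝ) (ccQ : ℚ) (l : List (ℕ × ℕ)) (N R : ℕ) :
    List (List ℝ) :=
  substMom (kernelPDL (fun ab => (cQ ab : ℝ)) l s (σQ : ℝ) (ccQ : ℝ)) (ccQ : ℝ) N R

/-- [folklore] -/
theorem pmem2_momTableI {S : ℕ} (hS : 0 < S) (cQ : ℕ × ℕ → ℚ) (σQ : ℚ) {s : ℝ} {sI : MI} (hs : MI.mem S s sI)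
    (ccQ : ℚ) (l : List (ℕ × ℕ)) (N R : ℕ) :
    PMem2 S (momTable cQ σQ s ccQ l N R) (momTableI S cQ σQ sI ccQ l N R) :=
  pmem2_substMomI hS (pmem2_kernelPDLI_of_mem hS hs cQ σQ ccQ l) ccQ N R

/-- **The q-sum value through the table**, `0 < E`, integer `j ≤ E`. [folklore] -/
theorem qSum_eq_eval2_momTable {S : ℕ} (hS : 0 < S) (cQ : ℕ × ℕ → ℚ) (σQ : ℚ) {s : ℝ} {sI : MI}
    (hs : MI.mem S s sI) (ccQ : ℚ) {l : List (ℕ × ℕ)} (hl : l.Nodup) {N R : ℕ}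
    (hN : kernelSizeOK S cQ σQ sI ccQ l N = true) (hR : momLenOK N R = true) {E : ℝ} (hE : 0 < E) (j : ℕ) :
    qSum (fun ab => (cQ ab : ℝ)) l.toFinset s (σQ : ℝ) E j =
      eval2 (momTable cQ σQ s ccQ l N R) (E - ccQ) ((j : ℝ) / E) :=
  qSum_eq_eval2_substMom _ hl s _ _ (size2_le_of_kernelSizeOK hS hs hN) hR hE j

/-- `θ = j/E ∈ [0,1]` for `0 ≤ j ≤ E`, `0 < E`. [folklore] -/
theorem div_mem_unit {E : ℝ} (hE : 0 < E) {j : ℕ} (hj : (j : ℝ) ≤ E) : 0 ≤ (j : ℝ) / E ∧ (j : ℝ) / E ≤ 1 :=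
  ⟨div_nonneg (Nat.cast_nonneg _) hE.le, (div_le_one hE).mpr hj⟩

/-! ### Even sector -/

/-- Data of an exact even-region check (as `EvenRegionData` plus the moment length `R`). [folklore] -/
structure EvenRegionDataEJ where
  S : ℕ
  l : List (ℕ × ℕ)
  cQ : Fin 5 → ℕ × ℕ → ℚ
  sσI : MI
  sεI : MI
  sbI : MI
  ccQ : ℚ
  P0 : ℚ
  N : ℕ
  R : ℕ
  prmX : HSParams
  prmY : HSParams
  prmD : HSParams

namespace EvenRegionDataEJ

/-- [folklore] -/
def TX (d : EvenRegionDataEJ) : IPoly2 := momTableI d.S (d.cQ 0) (-1) d.sσI d.ccQ d.l d.N d.R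
/-- [folklore] -/
def TY (d : EvenRegionDataEJ) : IPoly2 := momTableI d.S (d.cQ 1) (-1) d.sεI d.ccQ d.l d.N d.R
/-- [folklore] -/
def TZ (d : EvenRegionDataEJ) : IPoly2 :=
  add2I (momTableI d.S (d.cQ 3) (-1) d.sbI d.ccQ d.l d.N d.R) (momTableI d.S (d.cQ 4) 1 d.sbI d.ccQ d.l d.N d.R)
/-- [folklore] -/
def TD (d : EvenRegionDataEJ) : IPoly2 := add2I (smul2QI 4 (mul2I d.S d.TX d.TY)) (neg2I (mul2I d.S d.TZ d.TZ))

/-- **The exact even-region check.** [folklore] -/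
def check (d : EvenRegionDataEJ) : Bool :=
  decide (0 < d.S) && decide (0 < d.P0 + d.ccQ) && momLenOK d.N d.R &&
  kernelSizeOK d.S (d.cQ 0) (-1) d.sσI d.ccQ d.l d.N && kernelSizeOK d.S (d.cQ 1) (-1) d.sεI d.ccQ d.l d.N &&
  kernelSizeOK d.S (d.cQ 3) (-1) d.sbI d.ccQ d.l d.N && kernelSizeOK d.S (d.cQ 4) 1 d.sbI d.ccQ d.l d.N &&
  decide (1 ≤ d.prmX.θhi) && decide (1 ≤ d.prmY.θhi) && decide (1 ≤ d.prmD.θhi) &&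
  halfStripPos2 d.S d.TX d.P0 d.prmX && halfStripPos2 d.S d.TY d.P0 d.prmY && halfStripPos2 d.S d.TD d.P0 d.prmD

end EvenRegionDataEJ

/-- **The even region (λ-averaged termwise q-region) from the exact check.** [folklore] -/
theorem taylorEvenRegion_of_evenRegionCheckEJ (d : EvenRegionDataEJ) (hl : d.l.Nodup) (Q : Set (ℝ × ℝ))
    (hQ : ∀ p ∈ Q, MI.mem d.S p.1 d.sσI ∧ MI.mem d.S p.2 d.sεI ∧ MI.mem d.S ((p.1 + p.2) / 2) d.sbI)
    (h : d.check = true) :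
    TaylorEvenRegion (taylorCrossing (1 / 2) (1 / 2) d.l.toFinset fun i ab => (d.cQ i ab : ℝ)) Q
      ((d.P0 + d.ccQ : ℚ) : ℝ) := by
  simp only [EvenRegionDataEJ.check, Bool.and_eq_true, decide_eq_true_eq] at h
  obtain ⟨⟨⟨⟨⟨⟨⟨⟨⟨⟨⟨⟨hS, hE0⟩, hR⟩, hN0⟩, hN1⟩, hN3⟩, hN4⟩, hθX⟩, hθY⟩, hθD⟩, hX⟩, hY⟩, hD⟩ := h
  refine taylorEvenRegion_half_of_qRegion _ _ Q _ fun p hp E j hE hj => ?_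
  obtain ⟨hsσ, hsε, hsb⟩ := hQ p hp
  have hEpos : 0 < E := lt_of_lt_of_le (by exact_mod_cast hE0) hE
  have hθ := div_mem_unit hEpos hj
  have hP : ((d.P0 : ℚ) : ℝ) ≤ E - d.ccQ := by push_cast at hE; linarith
  have eX := qSum_eq_eval2_momTable hS (d.cQ 0) (-1) hsσ d.ccQ hl hN0 hR hEpos j
  have eY := qSum_eq_eval2_momTable hS (d.cQ 1) (-1) hsε d.ccQ hl hN1 hR hEpos j
  have eZ3 := qSum_eq_eval2_momTable hS (d.cQ 3) (-1) hsb d.ccQ hl hN3 hR hEpos j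
  have eZ4 := qSum_eq_eval2_momTable hS (d.cQ 4) 1 hsb d.ccQ hl hN4 hR hEpos j
  have pX := pmem2_momTableI hS (d.cQ 0) (-1) hsσ d.ccQ d.l d.N d.R
  have pY := pmem2_momTableI hS (d.cQ 1) (-1) hsε d.ccQ d.l d.N d.R
  have pZ := pmem2_add2I (pmem2_momTableI hS (d.cQ 3) (-1) hsb d.ccQ d.l d.N d.R)
    (pmem2_momTableI hS (d.cQ 4) 1 hsb d.ccQ d.l d.N d.R)
  have pD := pmem2_add2I (pmem2_smul2QI (4 : ℚ) (r := 4) (by norm_num) (pmem2_mul2I hS pX pY))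
    (pmem2_neg2I (pmem2_mul2I hS pZ pZ))
  have vX := halfStripPos2_sound hS pX hX hP hθ.1 (hθ.2.trans (by exact_mod_cast hθX))
  have vY := halfStripPos2_sound hS pY hY hP hθ.1 (hθ.2.trans (by exact_mod_cast hθY))
  have vD := halfStripPos2_sound hS pD hD hP hθ.1 (hθ.2.trans (by exact_mod_cast hθD))
  rw [eval2_add2, eval2_smul2, eval2_mul2, eval2_smul2, eval2_mul2, eval2_add2] at vD
  simp only [Rat.cast_neg, Rat.cast_one] at eX eY eZ3 eZ4
  have goalX : 0 ≤ qSum (fun ab => (d.cQ 0 ab : ℝ)) d.l.toFinset p.1 (-1) E j := by rw [eX]; exact vX.le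
  have goalY : 0 ≤ qSum (fun ab => (d.cQ 1 ab : ℝ)) d.l.toFinset p.2 (-1) E j := by rw [eY]; exact vY.le
  have goalD : (qSum (fun ab => (d.cQ 3 ab : ℝ)) d.l.toFinset ((p.1 + p.2) / 2) (-1) E j +
      qSum (fun ab => (d.cQ 4 ab : ℝ)) d.l.toFinset ((p.1 + p.2) / 2) 1 E j) ^ 2 ≤
      4 * qSum (fun ab => (d.cQ 0 ab : ℝ)) d.l.toFinset p.1 (-1) E j *
        qSum (fun ab => (d.cQ 1 ab : ℝ)) d.l.toFinset p.2 (-1) E j := by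
    rw [eX, eY, eZ3, eZ4, sq]
    linarith
  exact ⟨goalX, goalY, goalD⟩

/-! ### Odd cone -/

/-- Data of an exact odd-cone check. [folklore] -/
structure OddConeRegionDataEJ where
  S : ℕ
  l : List (ℕ × ℕ)
  cQ : Fin 5 → ℕ × ℕ → ℚ
  lψ : List (ℕ × ℕ)
  ψQ : ℕ × ℕ → ℚ
  κ₀Q : ℚ
  sσI : MI
  sbI : MI
  stI : MI
  K1 : MI
  K2 : MI
  K3 : MI
  ccQ : ℚ
  P0 : ℚ
  N : ℕ
  R : ℕ
  prmM1 : HSParams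
  prmM2 : HSParams
  prmR1 : HSParams
  prmR2 : HSParams

namespace OddConeRegionDataEJ

/-- [folklore] -/
def T3 (d : OddConeRegionDataEJ) : IPoly2 := momTableI d.S (d.cQ 2) (-1) d.sbI d.ccQ d.l d.N d.R
/-- [folklore] -/
def T4 (d : OddConeRegionDataEJ) : IPoly2 := momTableI d.S (d.cQ 3) (-1) d.sσI d.ccQ d.l d.N d.R
/-- [folklore] -/
def T5 (d : OddConeRegionDataEJ) : IPoly2 := momTableI d.S (d.cQ 4) 1 d.sσI d.ccQ d.l d.N d.R
/-- [folklore] -/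
def Tψ0 (d : OddConeRegionDataEJ) : IPoly2 := momTableI d.S d.ψQ 0 (MI.ofInt d.S 0) d.ccQ d.lψ d.N d.R
/-- [folklore] -/
def Tψt (d : OddConeRegionDataEJ) : IPoly2 := momTableI d.S d.ψQ 0 d.stI d.ccQ d.lψ d.N d.R
/-- [folklore] -/
def TM (d : OddConeRegionDataEJ) (ε : ℤ) : IPoly2 := add2I d.Tψ0 (smul2QI (-(ε : ℚ)) (smul2MI d.S d.K1 d.T3))
/-- [folklore] -/
def TR (d : OddConeRegionDataEJ) (ε : ℤ) : IPoly2 :=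
  add2I (add2I d.T4 (neg2I d.T5))
    (add2I (smul2QI (-(ε : ℚ) * (d.κ₀Q / 2)) (smul2MI d.S d.K2 d.T3))
      (smul2QI (-(d.κ₀Q⁻¹ / 2)) (smul2MI d.S d.K3 d.Tψt)))

/-- **The exact odd-cone check.** [folklore] -/
def check (d : OddConeRegionDataEJ) : Bool :=
  decide (0 < d.S) && decide (0 < d.κ₀Q) && decide (0 < d.P0 + d.ccQ) && momLenOK d.N d.R &&
  kernelSizeOK d.S (d.cQ 2) (-1) d.sbI d.ccQ d.l d.N && kernelSizeOK d.S (d.cQ 3) (-1) d.sσI d.ccQ d.l d.N &&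
  kernelSizeOK d.S (d.cQ 4) 1 d.sσI d.ccQ d.l d.N && kernelSizeOK d.S d.ψQ 0 (MI.ofInt d.S 0) d.ccQ d.lψ d.N &&
  kernelSizeOK d.S d.ψQ 0 d.stI d.ccQ d.lψ d.N &&
  decide (1 ≤ d.prmM1.θhi) && decide (1 ≤ d.prmM2.θhi) && decide (1 ≤ d.prmR1.θhi) && decide (1 ≤ d.prmR2.θhi) &&
  halfStripPos2 d.S (d.TM 1) d.P0 d.prmM1 && halfStripPos2 d.S (d.TM (-1)) d.P0 d.prmM2 &&
  halfStripPos2 d.S (d.TR 1) d.P0 d.prmR1 && halfStripPos2 d.S (d.TR (-1)) d.P0 d.prmR2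

end OddConeRegionDataEJ

/-- **The odd cone from the exact check** (the `odd_cone` field shape, `E_T = P₀ + cc`, `κ₀ = κ₀Q`). [folklore] -/
theorem oddCone_of_oddConeRegionCheckEJ (d : OddConeRegionDataEJ) (hl : d.l.Nodup) (hlψ : d.lψ.Nodup)
    (Q : Set (ℝ × ℝ))
    (hQ : ∀ p ∈ Q, MI.mem d.S p.1 d.sσI ∧ MI.mem d.S ((p.1 + p.2) / 2) d.sbI ∧ MI.mem d.S (p.1 - p.2) d.stI ∧
      MI.mem d.S ((1 / 2 : ℝ) ^ (p.1 + p.2)) d.K1 ∧ MI.mem d.S ((1 / 2 : ℝ) ^ (p.2 - p.1)) d.K2 ∧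
      MI.mem d.S ((1 / 2 : ℝ) ^ (-(2 * p.2))) d.K3)
    (h : d.check = true) :
    ∀ p ∈ Q, ∀ (E : ℝ) (j : ℕ), ((d.P0 + d.ccQ : ℚ) : ℝ) ≤ E → (j : ℝ) ≤ E →
      OddConeAt (taylorCrossing (1 / 2) (1 / 2) d.l.toFinset fun i ab => (d.cQ i ab : ℝ))
        (∑ ab ∈ d.lψ.toFinset, (d.ψQ ab : ℝ) • taylorCoeffAt (1 / 2) (1 / 2) ab) (d.κ₀Q : ℝ) p.1 p.2 E j := by
  simp only [OddConeRegionDataEJ.check, Bool.and_eq_true, decide_eq_true_eq] at h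
  obtain ⟨⟨⟨⟨⟨⟨⟨⟨⟨⟨⟨⟨⟨⟨⟨⟨hS, hκ₀⟩, hE0⟩, hR⟩, hN3⟩, hN4⟩, hN5⟩, hNψ0⟩, hNψt⟩, hθ1⟩, hθ2⟩, hθ3⟩, hθ4⟩,
    hM1⟩, hM2⟩, hR1⟩, hR2⟩ := h
  intro p hp E j hE hj
  obtain ⟨hsσ, hsb, hst, hK1, hK2, hK3⟩ := hQ p hp
  have hEpos : 0 < E := lt_of_lt_of_le (by exact_mod_cast hE0) hE
  have hθ := div_mem_unit hEpos hj
  have hP : ((d.P0 : ℚ) : ℝ) ≤ E - d.ccQ := by push_cast at hE; linarith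
  have h0mem : MI.mem d.S (0 : ℝ) (MI.ofInt d.S 0) := by simpa using MI.mem_ofInt d.S 0
  have e3 := qSum_eq_eval2_momTable hS (d.cQ 2) (-1) hsb d.ccQ hl hN3 hR hEpos j
  have e4 := qSum_eq_eval2_momTable hS (d.cQ 3) (-1) hsσ d.ccQ hl hN4 hR hEpos j
  have e5 := qSum_eq_eval2_momTable hS (d.cQ 4) 1 hsσ d.ccQ hl hN5 hR hEpos j
  have eψ0 := qSum_eq_eval2_momTable hS d.ψQ 0 h0mem d.ccQ hlψ hNψ0 hR hEpos j
  have eψt := qSum_eq_eval2_momTable hS d.ψQ 0 hst d.ccQ hlψ hNψt hR hEpos j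
  have p3 := pmem2_momTableI hS (d.cQ 2) (-1) hsb d.ccQ d.l d.N d.R
  have p4 := pmem2_momTableI hS (d.cQ 3) (-1) hsσ d.ccQ d.l d.N d.R
  have p5 := pmem2_momTableI hS (d.cQ 4) 1 hsσ d.ccQ d.l d.N d.R
  have pψ0 := pmem2_momTableI hS d.ψQ 0 h0mem d.ccQ d.lψ d.N d.R
  have pψt := pmem2_momTableI hS d.ψQ 0 hst d.ccQ d.lψ d.N d.R
  have pM : ∀ ε : ℤ, PMem2 d.S (add2 (momTable d.ψQ 0 0 d.ccQ d.lψ d.N d.R)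
      (smul2 (-(ε : ℝ)) (smul2 ((1 / 2 : ℝ) ^ (p.1 + p.2)) (momTable (d.cQ 2) (-1) ((p.1 + p.2) / 2) d.ccQ d.l d.N d.R))))
      (d.TM ε) := fun ε =>
    pmem2_add2I pψ0 (pmem2_smul2QI _ (by push_cast; ring) (pmem2_smul2MI hS hK1 p3))
  have pR : ∀ ε : ℤ, PMem2 d.S
      (add2 (add2 (momTable (d.cQ 3) (-1) p.1 d.ccQ d.l d.N d.R) (smul2 (-1) (momTable (d.cQ 4) 1 p.1 d.ccQ d.l d.N d.R)))
        (add2 (smul2 (-(ε : ℝ) * ((d.κ₀Q : ℝ) / 2))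
            (smul2 ((1 / 2 : ℝ) ^ (p.2 - p.1)) (momTable (d.cQ 2) (-1) ((p.1 + p.2) / 2) d.ccQ d.l d.N d.R)))
          (smul2 (-((d.κ₀Q : ℝ)⁻¹ / 2))
            (smul2 ((1 / 2 : ℝ) ^ (-(2 * p.2))) (momTable d.ψQ 0 (p.1 - p.2) d.ccQ d.lψ d.N d.R)))))
      (d.TR ε) := fun ε =>
    pmem2_add2I (pmem2_add2I p4 (pmem2_neg2I p5))
      (pmem2_add2I (pmem2_smul2QI _ (by push_cast; ring) (pmem2_smul2MI hS hK2 p3))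
        (pmem2_smul2QI _ (by push_cast; ring) (pmem2_smul2MI hS hK3 pψt)))
  have vM1 := halfStripPos2_sound hS (pM 1) hM1 hP hθ.1 (hθ.2.trans (by exact_mod_cast hθ1))
  have vM2 := halfStripPos2_sound hS (pM (-1)) hM2 hP hθ.1 (hθ.2.trans (by exact_mod_cast hθ2))
  have vR1 := halfStripPos2_sound hS (pR 1) hR1 hP hθ.1 (hθ.2.trans (by exact_mod_cast hθ3))
  have vR2 := halfStripPos2_sound hS (pR (-1)) hR2 hP hθ.1 (hθ.2.trans (by exact_mod_cast hθ4))
  simp only [eval2_add2, eval2_smul2, Int.cast_one, Int.cast_neg] at vM1 vM2 vR1 vR2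
  simp only [Rat.cast_neg, Rat.cast_one, Rat.cast_zero] at e3 e4 e5 eψ0 eψt
  rw [← e3, ← eψ0] at vM1 vM2
  rw [← e3, ← e4, ← e5, ← eψt] at vR1 vR2
  have hκ₁ : 0 ≤ (1 / 2 : ℝ) ^ (p.1 + p.2) := (Real.rpow_pos_of_pos (by norm_num) _).le
  have hκ₂ : 0 ≤ (1 / 2 : ℝ) ^ (p.2 - p.1) := (Real.rpow_pos_of_pos (by norm_num) _).le
  have hκ₀R : (0 : ℝ) < (d.κ₀Q : ℝ) := by exact_mod_cast hκ₀
  refine oddConeAt_half_of_qCone _ _ _ _ _ p.1 p.2 E j hj ?_ ?_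
  · rw [← abs_of_nonneg hκ₁, ← abs_mul, abs_le]
    constructor <;> linarith
  · have hc : 0 ≤ (d.κ₀Q : ℝ) / 2 * (1 / 2 : ℝ) ^ (p.2 - p.1) := by positivity
    rcases le_total 0 (qSum (fun ab => (d.cQ 2 ab : ℝ)) d.l.toFinset ((p.1 + p.2) / 2) (-1) E j) with h3 | h3
    · rw [abs_of_nonneg h3]; linarith
    · rw [abs_of_nonpos h3]
      have := mul_nonneg hc (neg_nonneg.mpr h3)
      nlinarith

end Summit.CriticalPhenomena.Ising3D
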